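import Summits.ResolutionOfSingularities.ResolutionOfSingularities.Theorems.RestrictCutKernels
import Summits.ResolutionOfSingularities.ResolutionOfSingularities.Theorems.FactorContactKernels
import Literature.AlgebraicGeometry.Resolution.BlowupsIntegral
import Literature.AlgebraicGeometry.Resolution.BlowupsProperProofs
import Literature.AlgebraicGeometry.Resolution.BirationalDimensionInequality
import Literature.AlgebraicGeometry.Resolution.AlterationsBoundarySmoothLocus
import Literature.AlgebraicGeometry.Resolution.PermissibleCentres
import Literature.AlgebraicGeometry.Resolution.RegularLocalRingsQuotient
import HarnessLib

/-!
# RestrictCutPort — decomp-res RIDER «PortDischarge» (lens-4 g34, critic row 194a (MAP (M-27723) +1)), tree file 1/4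
of the rider

Content VERBATIM from the decomp-res lens-4 g34 RIDER `HOME/decomp-res-lens-4/g34/FactorContactPortDischarge.lean`
(pin 9c49c6fa, 536 l; memo `rider/RIDER-g34.md`; HOME = run/shared/lean/pub/decomp-res) — MAP item (M-27723): the
registered port `HugValuationCut.FactorContactPortAll` (route item 27723, Theses aside
`MaxContactCut.FCFactorContactPortAll`) is DISCHARGED IN KERNEL and the g17 cell
`MaxContactCut.FCNoTameDriftingTowers` (item 27721, DECIDED-MOD-PORT) becomes DECIDED outright.  The rider's ll.
62–208 are a byte-identical CARRY of the node's §105 (`section Restrict`, landed as `Theorems/RestrictCutKernels`)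
and are DROPPED here (that module is imported instead); everything else is new, same namespace
`…Theorems.HugValuationCut`.  Farm (rider file, lens + critic runs): rc 0 · 0 err · 0 warn · 0 sorry · std axioms on
the key decls; file audit proof-of-item closed=True for 27723 AND 27721.  Critic: CRITIC-LEDGER row 194a (MAP
(M-27723) +1).  Landing orders = the critic rider INBOX :1163 (= the lens LANDING NOTE INBOX :1147 and the two `══
FILE` markers): FILE 1 `RestrictCutPort` = §111–§113 (cone-free; the `open …Theses` line dropped; imports
`RestrictCutKernels` + `FactorContactKernels` + Literature BlowupsIntegral / BlowupsProperProofs /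
BirationalDimensionInequality / AlterationsBoundarySmoothLocus / PermissibleCentres / RegularLocalRingsQuotient +
HarnessLib; `--kind proof --supports stmt-ResolutionOfSingularities-27723`); FILE 2 = §114 in the Theses cone, split
into one proof-of-item file per item as the rider allows: `MaxContactCutPortDischarge`
(`fcFactorContactPortAll_holds`, `--workitem stmt-ResolutionOfSingularities-27723`) and
`MaxContactCutPortDischarge2` (`fcNoTameDriftingTowers_holds`, `--workitem stmt-ResolutionOfSingularities-27721`).
These are ITEM CLOSINGS, not aside switches.

The rider header, verbatim:

> # FactorContactPortDischarge — decomp-res-lens-4 g34 RIDER «PortDischarge» to the node «RestrictCut» (MAP item (M-27723) of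
> CRITIC row 191: the registered port aside `MaxContactCut.FCFactorContactPortAll` (item 27723;
> `def FCFactorContactPortAll : Prop := HugValuationCut.FactorContactPortAll`, `FactorContactClasses.lean` :256–:263) is DISCHARGED IN
> KERNEL, AS REGISTERED — `theorem factorContactPortAll_holds : FactorContactPortAll` and, by name in the Theses cone,
> `theorem fcFactorContactPortAll_holds : MaxContactCut.FCFactorContactPortAll` — by the g33 factor calculus
(`FactorAt`, forcing law,
> `principal_facIter`, the transport engine `FactorAt.regularSurfaceHugging_of_absContact`) plus two NEW KERNELS of this rider:
>
> * §111 `tower_ringKrullDim_pt_eq` — THE RING DIMENSION AT THE MARKED POINTS IS CONSTANT ALONG A FORCED TOWER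
(restriction functor
>   of §105 to an integral root open + integrality / properness / birationality of blow-ups + «closed points of a
variety have local
>   dimension = dim»); corollary `threefoldTower_iff_root` («threefold» is a ROOT letter);
> * §112 `HugShadow.exists_factorAt` — an in-locus principal shadow IS a stalk factorization `𝓘_{m,x_m} = (g)·J` of weights
>   `(ν₀, n − ν₀)`, `ν₀ = ord g ≥ 1`; whence (§113) its weights never move, its strict transforms are the
weight-`ν₀` factor chain, its
>   g17-cofactors are the stalks of the weight-`(n − ν₀)` factor chain, `dim 𝒪_{x_{m+j}} = 3`, and an absolute
contact element on
>   either side is transported by the g33 engine to a hugged regular surface germ: `FactorContactPort n` for every `n ≥ 1`.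
>
> CARRY: §105 of the node (the restriction functor `towerRestrict`, HOME/decomp-res-lens-4/g34/RestrictCut.lean ll.
29–175) is repeated
> BYTE-IDENTICALLY below because the node is not yet importable; on landing drop the carry in favour of
> `import …Theorems.RestrictCutKernels`.  Landing form (two tree files, cut at the `══ FILE` markers): FILE 1
> `Theorems/RestrictCutPort.lean` = §111–§113 (cone-free: imports `RestrictCutKernels`, `FactorCutKernels2`,
`FactorContactKernels` + the
> six Literature files `BlowupsIntegral`, `BlowupsProperProofs`, `BirationalDimensionInequality`,
`AlterationsBoundarySmoothLocus`,
> `PermissibleCentres`, `RegularLocalRingsQuotient`), FILE 2 `Theorems/MaxContactCutPortDischarge.lean` = §114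
(Theses cone: imports FILE 1 +
> `Theses.MaxContactCut`; closes item 27723 `--kind proof`, conclusion `MaxContactCut.FCFactorContactPortAll` BY
NAME, and item 27721
> `MaxContactCut.FCNoTameDriftingTowers` BY NAME).

## This file

§111 (g34 rider · NEW · KERNEL) DIMENSION CONSTANCY ALONG FORCED TOWERS (`section DimensionConstancy`:
`tower_centre_ne_bot`, `tower_ringKrullDim_pt_eq` — dim 𝒪_{X_i,x_i} = dim 𝒪_{X_0,x_0} along ANY forced tower over an
`IsBase` root with n ≥ 1, via (R) `towerRestrict` to an integral root open, blow-ups of integral schemes in non-zero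
centres being integral / proper / birational ⇒ equal topological Krull dimension, closed marked points of
k-varieties ⇒ ring dimension = topological dimension; cor. `threefoldTower_iff_root` «threefold is a ROOT letter»);
§112 (NEW · KERNEL) AN IN-LOCUS PRINCIPAL SHADOW IS A STALK FACTORIZATION (`section ShadowFactor`:
`colon_span_singleton_mul_eq`, `HugShadow.exists_factorAt` — 𝓘_{m,x_m} = (g₀)·J of weights (ν₀, n−ν₀),
`HugShadow.ringKrullDim_eq_three`); §113 (NEW · KERNEL) THE PORT DISCHARGED (`section PortDischarge`:
`factorContactPort_holds (n) (hn : 1 ≤ n) : FactorContactPort n` — g17's port with ITS binder, no restated port, no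
new letter; `factorContactPortAll_holds : FactorContactPortAll` = item 27723's body verbatim;
`noTameDriftingTowers_holds : NoTameDriftingTowers`) — continued in `RestrictCutPort2`… where the 400-line cap cuts.
 (This first part carries: `tower_centre_ne_bot`, `tower_ringKrullDim_pt_eq`, `threefoldTower_iff_root`,
`colon_span_singleton_mul_eq`, `hugsGerm_generator_ne_zero_mem`, `HugShadow.exists_factorAt`,
`HugShadow.ringKrullDim_eq_three`.)

[WRITER NOTE (decomp-res writer g12): file split only (tree files ≤ 400 lines); namespace, sections, section
variables / universes / opens and every declaration exactly as in the rider (its §105 carry and file-level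
dupNamespace-linter line dropped; the `open …Theses` line lives only in the Theses-cone files `MaxContactCutPortDischarge*`).]

(Sources: Hironaka1964 Ch. III; Giraud1975; Kollar2007 3.58–3.60; CossartJannsenSaito2020 Thm. 6.40, Ch. 8;
Hauser2010Kangaroo; HauserPerlega2019 §2; CossartPiltant2008 §2; deJong1996; Hironaka2005; EGAIV2 §5 (dimension),
EGAIV4 §16, §21; Matsumura1987 §14–§15 (dimension of quotients), §20, §28; Liu2002 §8.2 (blow-ups: integrality,
birationality, dimension); StacksProject 02ND / 0804 / 0BIQ / 031I / 0AFT.)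
-/

noncomputable section

open CategoryTheory AlgebraicGeometry IsLocalRing TopologicalSpace
open Literature.AlgebraicGeometry.Resolution
open Literature.AlgebraicGeometry.Resolution.Hironaka2005 (le_idealOrder_of_mul_le le_idealOrder_of_mul_le')
open Summit.ResolutionOfSingularities.ResolutionOfSingularities.Theorems
open WeakOrderReduction ForcedTowerClasses DivergentTowerClasses MonomialTowerClasses
open HugDimensionClasses HugDimensionKernels SurfaceShadowClasses SurfaceShadowKernels
open NearPointCut (SingularClass)
open AbsoluteContactClasses (IsAbsContactAt)
open Scheme.IdealSheafData (vanishingIdeal)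
open scoped BigOperators nonZeroDivisors

namespace Summit.ResolutionOfSingularities.ResolutionOfSingularities.Theorems.HugValuationCut

section DimensionConstancy

variable {k : Type} [Field k]

/-! ## ══ FILE 1/2 `Theorems/RestrictCutPort.lean` (§111–§113; cone-free) ══ -/

/-! ## §111 (g34 rider · NEW · KERNEL) THE RING DIMENSION AT THE MARKED POINTS IS CONSTANT ALONG A FORCED TOWER

`dim 𝒪_{X_i,x_i} = dim 𝒪_{X_0,x_0}` for every forced tower over an `IsBase` root with an order-bounded datum of weight `n ≥ 1`.
Proof by the restriction functor of §105: restrict the tower to an INTEGRAL root open `U₀ ∋ x_0`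
(`exists_opens_isIntegral`, regular
local schemes are locally integral); every stage of `T|U₀` is then integral — a blow-up of an integral scheme in a
NON-ZERO centre is
integral (`IsBlowup.isIntegral`, Stacks 02ND), and the centre `𝓘_{x_i} ⊆ 𝓘(x_i)_{x_i} = 𝔪_{x_i}` is non-zero because
`ord_{x_i} 𝓘_i = n` is finite —, every blow-up is proper (`IsBlowup.isProper`) and birational (`IsBlowup.isBirational'`), so all
stages have the same dimension (`IsBirational.topologicalKrullDim_eq_of_isProper`, Görtz–Wedhorn II 26.29), and at
the CLOSED marked
points of these `k`-varieties the local rings have the dimension of the stage (`ringKrullDim_stalk_eq_of_isClosed`);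
finally the marked
local rings of `T|U₀` are those of `T` (`towerRestrict_ringKrullDim_stalk`).  Corollary: «threefold tower» is a ROOT letter. -/

/-- **the centre of a forced tower is a non-zero ideal sheaf**: its stalk at the marked point is `𝔪_{x_i} ⊇ 𝓘_{i,x_i} ≠ 0`
(`ord_{x_i} 𝓘_i = n < ∞`). [folklore] -/
theorem tower_centre_ne_bot (T : ForcedTower) (g : T.St 0 ⟶ Spec (.of k)) (hB : IsBase (T.St 0) g) {n : ℕ}
    (hD : IsDatum n (T.D 0)) (hn : 1 ≤ n) (i : ℕ) : T.centre i ≠ ⊥ := by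
  intro h
  have hst : stalkIdeal (T.centre i) (T.pt i) = maximalIdeal _ := by
    rw [tower_centre_eq_vanishingIdeal T i]
    exact stalkIdeal_vanishingIdeal_singleton (T.isClosed_pt i)
  have hbot : stalkIdeal (T.centre i) (T.pt i) = ⊥ := by
    obtain ⟨U, hU, hxU, -⟩ := exists_isAffineOpen_mem_and_subset (X := T.St i) (x := T.pt i) (U := ⊤) (Opens.mem_top _)
    rw [h, stalkIdeal_eq_map_germ ⊥ ⟨U, hU⟩ hxU, Scheme.IdealSheafData.ideal_bot, Pi.bot_apply, Ideal.map_bot]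
  have hord := tower_idealOrder_pt_eq T g hB hD i
  have hle : stalkIdeal (T.D i).ideal (T.pt i) ≤ maximalIdeal _ ^ n := (le_idealOrder_iff _ _ n).mp hord.ge
  have hIbot : stalkIdeal (T.D i).ideal (T.pt i) = ⊥ :=
    le_bot_iff.mp ((hle.trans (Ideal.pow_le_self (by omega))).trans (hst.symm.trans hbot).le)
  have htop : idealOrder (T.D i).ideal (T.pt i) = ⊤ :=
    ENat.eq_top_iff_forall_ge.mpr fun c => (le_idealOrder_iff _ _ c).mpr (by rw [hIbot]; exact bot_le)
  rw [hord] at htop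
  exact ENat.coe_ne_top n htop

/-- **THE RING DIMENSION AT THE MARKED POINTS IS CONSTANT ALONG A FORCED TOWER.** (Sources: Stacks 02ND; GoertzWedhorn2023,
Thm. 26.29; Hartshorne1977, II Ex. 3.20.) -/
theorem tower_ringKrullDim_pt_eq (T : ForcedTower) (g : T.St 0 ⟶ Spec (.of k)) (hB : IsBase (T.St 0) g) {n : ℕ}
    (hD : IsDatum n (T.D 0)) (hn : 1 ≤ n) (i : ℕ) :
    ringKrullDim ((T.St i).presheaf.stalk (T.pt i)) = ringKrullDim ((T.St 0).presheaf.stalk (T.pt 0)) := by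
  have hN : ∀ i, IsLocallyNoetherian (T.St i) := fun i => (tower_isLocallyNoetherian_isRegular T g hB i).1
  haveI := hN 0
  obtain ⟨U₀, h0, hint⟩ := Hironaka2005.exists_opens_isIntegral hB.isRegular (T.pt 0)
  have hB' := towerRestrict_isBase T hN U₀ h0 g hB
  have hD' := towerRestrict_isDatum T hN U₀ h0 hD
  -- every stage of `T|U₀` is integral, and its marked local ring has the dimension of the root's
  have key : ∀ j, IsIntegral ((towerRestrict T hN U₀ h0).St j) ∧
      ringKrullDim (((towerRestrict T hN U₀ h0).St j).presheaf.stalk ((towerRestrict T hN U₀ h0).pt j)) =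
        ringKrullDim (((towerRestrict T hN U₀ h0).St 0).presheaf.stalk ((towerRestrict T hN U₀ h0).pt 0)) := by
    intro j
    induction j with
    | zero => exact ⟨hint, rfl⟩
    | succ j ih =>
      haveI : IsIntegral ((towerRestrict T hN U₀ h0).St j) := ih.1
      haveI : IsLocallyNoetherian ((towerRestrict T hN U₀ h0).St j) :=
        (tower_isLocallyNoetherian_isRegular (towerRestrict T hN U₀ h0) (U₀.ι ≫ g) hB' j).1
      haveI : IsLocallyNoetherian ((towerRestrict T hN U₀ h0).St (j + 1)) :=
        (tower_isLocallyNoetherian_isRegular (towerRestrict T hN U₀ h0) (U₀.ι ≫ g) hB' (j + 1)).1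
      have hπ := (towerRestrict T hN U₀ h0).isBlowup j
      have hne : (towerRestrict T hN U₀ h0).centre j ≠ ⊥ :=
        tower_centre_ne_bot (towerRestrict T hN U₀ h0) (U₀.ι ≫ g) hB' hD' hn j
      haveI : IsIntegral ((towerRestrict T hN U₀ h0).St (j + 1)) := hπ.isIntegral hne
      haveI : IsProper ((towerRestrict T hN U₀ h0).π j) := hπ.isProper
      have hdim : topologicalKrullDim ((towerRestrict T hN U₀ h0).St (j + 1)) =
          topologicalKrullDim ((towerRestrict T hN U₀ h0).St j) :=
        (hπ.isBirational' hne).topologicalKrullDim_eq_of_isProper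
      haveI : LocallyOfFiniteType (toRoot (towerRestrict T hN U₀ h0) (j + 1) ≫ (U₀.ι ≫ g)) :=
        (tower_isBase (towerRestrict T hN U₀ h0) (U₀.ι ≫ g) hB' (j + 1)).locallyOfFiniteType
      haveI : LocallyOfFiniteType (toRoot (towerRestrict T hN U₀ h0) j ≫ (U₀.ι ≫ g)) :=
        (tower_isBase (towerRestrict T hN U₀ h0) (U₀.ι ≫ g) hB' j).locallyOfFiniteType
      refine ⟨inferInstance, ?_⟩
      rw [← ih.2, ringKrullDim_stalk_eq_of_isClosed (toRoot (towerRestrict T hN U₀ h0) (j + 1) ≫ (U₀.ι ≫ g))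
          ((towerRestrict T hN U₀ h0).isClosed_pt (j + 1)),
        ringKrullDim_stalk_eq_of_isClosed (toRoot (towerRestrict T hN U₀ h0) j ≫ (U₀.ι ≫ g))
          ((towerRestrict T hN U₀ h0).isClosed_pt j), hdim]
  rw [← towerRestrict_ringKrullDim_stalk T hN U₀ h0 i, (key i).2, towerRestrict_ringKrullDim_stalk T hN U₀ h0 0]

/-- **«THREEFOLD TOWER» IS A ROOT LETTER**: a forced tower is a threefold tower iff `dim 𝒪_{X_0,x_0} = 3` (as the pair of root
letters `DimThreeAt T 0 ∧ ¬ DimFourAt T 0`). [folklore] -/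
theorem threefoldTower_iff_root (T : ForcedTower) (g : T.St 0 ⟶ Spec (.of k)) (hB : IsBase (T.St 0) g) {n : ℕ}
    (hD : IsDatum n (T.D 0)) (hn : 1 ≤ n) : ThreefoldTower T ↔ (DimThreeAt T 0 ∧ ¬ DimFourAt T 0) := by
  refine ⟨fun h => h 0, fun h i => ?_⟩
  unfold DimThreeAt DimFourAt
  rw [tower_ringKrullDim_pt_eq T g hB hD hn i]
  exact h

end DimensionConstancy

section ShadowFactor

variable {k : Type} [Field k]

/-! ## §112 (g34 rider · NEW · KERNEL) THE SHADOW FACTORIZATION: AN IN-LOCUS PRINCIPAL SHADOW IS A `FactorAt`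

At the hugging stage `m` of an IN-LOCUS (`𝓘_{m,x_m} ⊆ 𝓘(Σ)_{x_m}`) PRINCIPAL (`𝓘(Σ)_{x_m} = (g)`) shadow the marked stalk
FACTORS: `𝓘_{m,x_m} = (g) · J`, `J := (𝓘_{m,x_m} : (g))` the g17 cofactor, `ord g = ν₀ = ν_0(Σ) ≥ 1`, `ord J = n − ν₀` (orders
add in the regular local ring `𝒪_{x_m}`) — a `FactorAt T m ν₀ (n − ν₀) (𝓘(Σ)) K₀` for an ideal sheaf `K₀` spreading `J`
(`centreSpread`; `K₀ = ⊤` when `J = (1)`).  By the FORCING LAW of g33 the weights then never move (an in-locus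
principal shadow is
STABLE FROM ITS HUGGING STAGE; weight descent has no teeth on it), the strict transforms of the germ ARE the
weight-`ν₀` factor chain
(`FactorAt.principal_facIter`), and the g17 cofactors `J_j` are the stalks of the weight-`(n − ν₀)` factor chain (§113). -/

/-- colon algebra in a domain: `((g)·K : (g)) = K` for `g ≠ 0`. [folklore] -/
theorem colon_span_singleton_mul_eq {R : Type*} [CommRing R] [IsDomain R] {g : R} (hg : g ≠ 0) (K : Ideal R) :
    Submodule.colon (Ideal.span {g} * K) ((Ideal.span {g} : Ideal R) : Set R) = K := by
  refine le_antisymm (fun y hy => ?_) (fun y hy => ?_)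
  · have h : y * g ∈ Ideal.span {g} * K := Submodule.mem_colon.mp hy g (Ideal.mem_span_singleton_self g)
    rw [mul_comm (Ideal.span {g}) K] at h
    obtain ⟨z, hz, hzg⟩ := Ideal.mem_mul_span_singleton.mp h
    rw [← mul_right_cancel₀ hg hzg]
    exact hz
  · refine Submodule.mem_colon.mpr fun s hs => ?_
    show y * s ∈ Ideal.span {g} * K
    rw [mul_comm (Ideal.span {g}) K]
    exact Ideal.mul_mem_mul hy hs

/-- a principal hugged germ has a NON-ZERO generator in `𝔪_{x_m}` (finite order; the marked point lies on the germ).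
[folklore] -/
theorem hugsGerm_generator_ne_zero_mem {T : ForcedTower} {m : ℕ} {H : (T.St m).IdealSheafData} (hh : HugsGerm T m H)
    [(stalkIdeal H (T.pt m)).IsPrincipal] :
    Submodule.IsPrincipal.generator (stalkIdeal H (T.pt m)) ≠ 0 ∧
      Submodule.IsPrincipal.generator (stalkIdeal H (T.pt m)) ∈ maximalIdeal _ := by
  have hG : stalkIdeal H (T.pt m) = Ideal.span {Submodule.IsPrincipal.generator (stalkIdeal H (T.pt m))} :=
    (Ideal.span_singleton_generator _).symm
  refine ⟨fun h0 => hh.1 ?_, ?_⟩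
  · refine ENat.eq_top_iff_forall_ge.mpr fun c => (le_idealOrder_iff _ _ c).mpr ?_
    rw [hG, Ideal.span_singleton_eq_bot.mpr h0]
    exact bot_le
  · have hmem : T.pt m ∈ (H.support : Set (T.St m)) := hh.2 0
    have hle := (mem_support_iff_stalkIdeal_le _ _).mp hmem
    rw [hG] at hle
    exact hle (Ideal.mem_span_singleton_self _)

/-- **THE SHADOW FACTORIZATION** (KERNEL): an in-locus principal shadow of a forced tower of weight `n` over an
`IsBase` root is a
stalk factorization of the marked ideal at its hugging stage, of weights `(ν₀, n − ν₀)` with `1 ≤ ν₀ = ν_0(Σ) ≤ n`, whose first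
factor IS the germ. (Sources: CossartJannsenSaito2020, §6 (D1)–(D2); Matsumura1987, Thm. 14.2.) -/
theorem HugShadow.exists_factorAt {T : ForcedTower} (S : HugShadow T) (g : T.St 0 ⟶ Spec (.of k)) (hB : IsBase (T.St 0) g)
    {n : ℕ} (hD : IsDatum n (T.D 0)) (hL : S.InLocus) (hP : S.Principal) :
    ∃ (ν₀ : ℕ) (K₀ : (T.St S.m).IdealSheafData), 1 ≤ ν₀ ∧ ν₀ ≤ n ∧ S.topOrder 0 = ν₀ ∧
      FactorAt T S.m ν₀ (n - ν₀) S.germ K₀ := by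
  haveI : IsRegularLocalRing ((T.St S.m).presheaf.stalk (T.pt S.m)) := (tower_isLocallyNoetherian_isRegular T g hB S.m).2 _
  have hR : IsRegularLocalRing ((T.St S.m).presheaf.stalk (T.pt S.m)) := ‹_›
  haveI := tower_isNoetherian T g hB S.m
  -- the order `ν₀` of the germ at `x_m`
  obtain ⟨ν₀, hν₀⟩ := ENat.ne_top_iff_exists.mp S.hugs.1
  have hn : idealOrder (T.D S.m).ideal (T.pt S.m) = ((n : ℕ) : ℕ∞) := tower_idealOrder_pt_eq T g hB hD S.m
  have h1 : 1 ≤ ν₀ := by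
    have h : 1 ≤ idealOrder S.germ (T.pt S.m) := S.one_le_topOrder 0
    rw [← hν₀] at h
    exact_mod_cast h
  have hle : ν₀ ≤ n := by
    have h : idealOrder S.germ (T.pt S.m) ≤ idealOrder (T.D S.m).ideal (T.pt S.m) := S.topOrder_zero_le_order hL
    rw [← hν₀, hn] at h
    exact_mod_cast h
  -- the generator `g₀` and the cofactor `J = (𝓘 : (g₀))`, `𝓘 = (g₀)·J`
  haveI : (stalkIdeal S.germ (T.pt S.m)).IsPrincipal := hP
  have hG : stalkIdeal S.germ (T.pt S.m) = Ideal.span {Submodule.IsPrincipal.generator (stalkIdeal S.germ (T.pt S.m))} :=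
    (Ideal.span_singleton_generator _).symm
  set g₀ := Submodule.IsPrincipal.generator (stalkIdeal S.germ (T.pt S.m)) with hg₀
  set J : Ideal ((T.St S.m).presheaf.stalk (T.pt S.m)) :=
    Submodule.colon (stalkIdeal (T.D S.m).ideal (T.pt S.m)) ((Ideal.span {g₀} : Ideal _) : Set _) with hJ
  have hIJ : stalkIdeal (T.D S.m).ideal (T.pt S.m) = Ideal.span {g₀} * J := by
    refine le_antisymm (fun x hx => ?_) (Ideal.mul_le.mpr fun r hr s hs => ?_)
    · have hxG : x ∈ Ideal.span {g₀} := hG ▸ hL hx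
      obtain ⟨a, rfl⟩ := Ideal.mem_span_singleton'.mp hxG
      rw [mul_comm (Ideal.span {g₀}) J]
      refine Ideal.mul_mem_mul (Submodule.mem_colon.mpr fun s hs => ?_) (Ideal.mem_span_singleton_self g₀)
      obtain ⟨b, rfl⟩ := Ideal.mem_span_singleton'.mp hs
      show a * (b * g₀) ∈ stalkIdeal (T.D S.m).ideal (T.pt S.m)
      rw [← mul_assoc, mul_comm a b, mul_assoc]
      exact Ideal.mul_mem_left _ b hx
    · have h : s * r ∈ stalkIdeal (T.D S.m).ideal (T.pt S.m) := Submodule.mem_colon.mp hs r hr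
      exact mul_comm s r ▸ h
  -- an ideal sheaf `K₀` with stalk `J` at `x_m`
  obtain ⟨K₀, hK₀⟩ : ∃ K₀ : (T.St S.m).IdealSheafData, stalkIdeal K₀ (T.pt S.m) = J := by
    by_cases hJtop : J = ⊤
    · exact ⟨⊤, (stalkIdeal_top _).trans hJtop.symm⟩
    · have hJbot : J ≠ ⊥ := by
        intro hJ0
        have hI0 : stalkIdeal (T.D S.m).ideal (T.pt S.m) = ⊥ := by rw [hIJ, hJ0, Ideal.mul_bot]
        have htop : idealOrder (T.D S.m).ideal (T.pt S.m) = ⊤ :=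
          ENat.eq_top_iff_forall_ge.mpr fun c => (le_idealOrder_iff _ _ c).mpr (by rw [hI0]; exact bot_le)
        rw [hn] at htop
        exact ENat.coe_ne_top n htop
      obtain ⟨r, c, hc⟩ := Submodule.fg_iff_exists_fin_generating_family.mp (IsNoetherian.noetherian J)
      have hc' : Ideal.span (Set.range c) = J := hc
      obtain ⟨K₀, -, -, hK₀⟩ := FInjectiveMacaulayfication.CentreSpread.centreSpread (T.St S.m) (T.pt S.m) r c
        (by rw [hc']; exact hJbot) (by rw [hc']; exact IsLocalRing.le_maximalIdeal hJtop)
      exact ⟨K₀, hK₀.trans hc'⟩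
  -- the stalks multiply, the orders are `ν₀` and `n − ν₀`
  have hmul : stalkIdeal (T.D S.m).ideal (T.pt S.m) = stalkIdeal S.germ (T.pt S.m) * stalkIdeal K₀ (T.pt S.m) := by
    rw [hG, hK₀]; exact hIJ
  have hprod : idealOrder (S.germ * K₀) (T.pt S.m) = ((n : ℕ) : ℕ∞) := by
    rw [← idealOrder_congr_stalk (I := (T.D S.m).ideal) (by rw [stalkIdeal_mul]; exact hmul)]
    exact hn
  refine ⟨ν₀, K₀, h1, hle, hν₀.symm, hmul, hν₀.symm, le_antisymm ?_ ?_⟩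
  · -- `ord K₀ ≤ n − ν₀`: else the product would have order `> n`
    by_contra hlt
    rw [not_le] at hlt
    have hge : ((n - ν₀ + 1 : ℕ) : ℕ∞) ≤ idealOrder K₀ (T.pt S.m) := by
      have := (ENat.add_one_le_iff (ENat.coe_ne_top (n - ν₀))).mpr hlt
      exact_mod_cast this
    have h2 : ((ν₀ + (n - ν₀ + 1) : ℕ) : ℕ∞) ≤ idealOrder (S.germ * K₀) (T.pt S.m) := by
      rw [le_idealOrder_iff, stalkIdeal_mul, pow_add]
      exact Ideal.mul_mono ((le_idealOrder_iff _ _ ν₀).mp hν₀.le) ((le_idealOrder_iff _ _ _).mp hge)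
    rw [hprod] at h2
    have := ENat.coe_le_coe.mp h2
    omega
  · -- `n − ν₀ ≤ ord K₀`: orders add in the regular local ring
    exact le_idealOrder_of_mul_le' hR (by rw [hprod]; exact_mod_cast (by omega : ν₀ + (n - ν₀) ≤ n)) hν₀.symm.le

/-- **in-locus principal shadows live in RING DIMENSION THREE at the hugging point**: `dim 𝒪_{x_m} = dim 𝒪_{x_m}/(g) + 1 = 3`
(`g` a non-zero element of `𝔪` in the regular local domain). (Sources: Matsumura1987, Thm. 14.2 / Stacks 00KW.) -/
theorem HugShadow.ringKrullDim_eq_three {T : ForcedTower} (S : HugShadow T) (g : T.St 0 ⟶ Spec (.of k))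
    (hB : IsBase (T.St 0) g) (hP : S.Principal) : ringKrullDim ((T.St S.m).presheaf.stalk (T.pt S.m)) = 3 := by
  haveI : IsRegularLocalRing ((T.St S.m).presheaf.stalk (T.pt S.m)) := (tower_isLocallyNoetherian_isRegular T g hB S.m).2 _
  haveI := isDomain_of_isRegularLocalRing ((T.St S.m).presheaf.stalk (T.pt S.m))
  haveI : (stalkIdeal S.germ (T.pt S.m)).IsPrincipal := hP
  obtain ⟨hg0, hgm⟩ := hugsGerm_generator_ne_zero_mem S.hugs
  have hG : stalkIdeal S.germ (T.pt S.m) = Ideal.span {Submodule.IsPrincipal.generator (stalkIdeal S.germ (T.pt S.m))} :=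
    (Ideal.span_singleton_generator _).symm
  have h2 := S.dim_two
  rw [hG] at h2
  have h1 := ringKrullDim_quotient_span_singleton_succ_eq_ringKrullDim_of_mem_nonZeroDivisors
    (mem_nonZeroDivisors_of_ne_zero hg0) hgm
  rw [h2] at h1
  obtain ⟨d, hd⟩ := exists_nat_cast_eq_ringKrullDim (R := (T.St S.m).presheaf.stalk (T.pt S.m))
  rw [hd] at h1 ⊢
  have h3 : 2 + 1 = d := by exact_mod_cast h1
  subst h3
  rfl

end ShadowFactor

end Summit.ResolutionOfSingularities.ResolutionOfSingularities.Theorems.HugValuationCut
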